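import Summits.QuantumAdvantage.QuantumAdvantage.Theorems.NearExactIsExact.Negative.ProductTest
import Summits.QuantumAdvantage.QuantumAdvantage.Theorems.NearExactIsExact.Negative.RMDual
import Summits.QuantumAdvantage.QuantumAdvantage.Theorems.CubicForrelationNearExactIsExactRothausB

/-!
# `NearExactIsExact` (stmt-QuantumAdvantage-14043) — MM-GAP for bijective biquadratic Maiorana–McFarland pairs
  at `n = 18` and `n = 20`: `Φ = 1 ∨ Φ ≤ 15/16` (windows BQQ(9), BQQ(10))

Habitat (b2b cell, DISPROOF §10.4–§10.5): `π, τ` mutually inverse coordinatewise QUADRATIC maps of `𝔽₂ˢ`,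
`c₁, c₂` cubic, residual `r = c₁ ⊕ c₂∘π` of weight `w`; the bijective Maiorana–McFarland cubic pair built on them
at `n = 2s` has `Φ = 1 − 2w/2ˢ` (`MmPairFixedPoints.forrelation_mmPair_of_leftInverse`), so `Φ ∈ (15/16, 1)` iff
`0 < w < 2^{s−5}`. Kernel-checked before: `s = 7` (`BqqSeven`), `s = 8` (`BqqEightNineTen.bqq_eight`, sharp).
DISPROOF §10.4 closes `s = 9, 10` on paper through the Kasami–Tokura weight classification; this file gives a
SHORT proof needing only the product test (`ProductTest.productTest`), Reed–Muller duality
(`RMDual.isDegLeFun_of_orthogonal`) and the Reed–Muller minimum weight (`bb_rmWeight_holds`):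

* CELLS. For a function `q` of degree `d₂` the "cell" `r ∧ q∘π` is orthogonal to `RM(2,s)` as soon as the test
  `(2, d₂)` is available (`5 + 2d₂ < s` and `7 + d₂ < s`), hence has degree
  `≤ s − 3` and is EMPTY or has `≥ 8` points (`cell_weight`). At `s = 9` this applies to affine `q`
  (coordinate half-spaces `π(y)_i = v`), at `s = 10` to quadratic `q` (quarter-spaces `π(y)_i = v ∧ π(y)_j = w`).
* KERNELS (pure counting, `one_cell_kernel`, `two_cell_kernel`). Let `B = π(supp r)` (`π` injective, `w ≥ 2`
  points). Two points of `B` differ in a coordinate `i`, so both half-cells of `i` are non-empty, each `≥ T = 8`: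
  `w ≥ 2T` — contradiction at `s = 9` where the window is `w < 16`. At `s = 10` (`w < 32 = 4T`) one half-cell `D`
  has `T ≤ |D| < 2T`; any coordinate `j` splitting `D` would cut it into two non-empty quarter-cells, each `≥ T` —
  impossible — so the `≥ 2` points of `D` agree in every coordinate, contradicting injectivity.

Results: `bqq_nine` (`w ∈ {0} ∪ [16,∞)` at `s = 9`), `bqq_ten` (`w ∈ {0} ∪ [32,∞)` at `s = 10`), and the
Forrelation corollaries `forrelation_bijectiveMm_eighteen`, `forrelation_bijectiveMm_twenty`: every bijective
biquadratic Maiorana–McFarland cubic pair at `n = 18, 20` has `Φ = 1 ∨ Φ ≤ 15/16`; at `n = 20` this is SHARP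
(`PentagonFifteenSixteenths.exists_bijectiveMm_pair_fifteen_sixteenths`, `w = 32`). Together with `BqqSeven`,
`BqqEightNineTen`: MM-GAP (`Φ ∈ {1} ∪ [0, 15/16]`) is kernel-checked for this class at `n = 14, 16, 18, 20`.

HONEST FRAMING: THEOREMS about finite slices `n ≤ 20` of ONE habitat of the crux — NOT summit progress (no violation
of `NearExactIsExact`; the class is not known to contain the extremisers; `s ≥ 11` stays open here).
Sources (orientation only): F. J. MacWilliams, N. J. A. Sloane, The Theory of Error-Correcting Codes (1977), Ch. 13;
everything used is proved in the tree; standard axioms.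
-/

set_option linter.dupNamespace false -- D-0017: single-problem summit ⇒ `QuantumAdvantage.QuantumAdvantage` by design

namespace Summit.QuantumAdvantage.QuantumAdvantage.Theorems.NearExactIsExact.Negative.BqqNineTen

open Finset
open Literature.Computability.QuantumComplexity
open Summit.QuantumAdvantage.QuantumAdvantage.Theorems.CubicForrelation.NearExactIsExact
  (te_isDegLeFun_band bb_rmWeight_holds fc_sum_signOf_eq_card fc_deg_bxor)
open Summit.QuantumAdvantage.QuantumAdvantage.Theorems.NearExactIsExact.Negative.MmPairFixedPoints
  (forrelation_mmPair_of_leftInverse)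
open Summit.QuantumAdvantage.QuantumAdvantage.Theorems.NearExactIsExact.Negative.ProductTest (productTest)
open Summit.QuantumAdvantage.QuantumAdvantage.Theorems.NearExactIsExact.Negative.RMDual (isDegLeFun_of_orthogonal)

/-! ### Counting kernels -/

/-- `(x ⊕ ¬v) = 1 ↔ x = v`. [folklore] -/
theorem xor_not_eq_true_iff (x v : Bool) : (x ^^ !v) = true ↔ x = v := by
  cases x <;> cases v <;> decide

/-- Two disjoint subsets of `u` have at most `#u` elements together. [folklore] -/
theorem card_add_card_le {α : Type*} [DecidableEq α] {s t u : Finset α} (hs : s ⊆ u) (ht : t ⊆ u)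
    (hst : Disjoint s t) : #s + #t ≤ #u := by
  rw [← card_union_of_disjoint hst]
  exact card_le_card (union_subset hs ht)

/-- **One-cell kernel.** If the coordinates `b i` separate the points of `supp r` (`≥ 2` of them) and every
non-empty half-cell `supp r ∩ {b i = v}` has `≥ T` points, then `#supp r ≥ 2T`. [folklore] -/
theorem one_cell_kernel {α : Type*} [Fintype α] {ι : Type*} (r : α → Bool) (b : ι → α → Bool) (T : ℕ)
    (h1 : ∀ i (v : Bool), (∃ a, r a = true ∧ b i a = v) →
      T ≤ #(univ.filter fun a => r a = true ∧ b i a = v))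
    (hsep : ∀ a a', r a = true → r a' = true → (∀ i, b i a = b i a') → a = a')
    (htwo : 2 ≤ #(univ.filter fun a => r a = true))
    (hlt : #(univ.filter fun a => r a = true) < 2 * T) : False := by
  classical
  obtain ⟨a, ha, a', ha', hne⟩ := one_lt_card.mp htwo
  simp only [mem_filter, mem_univ, true_and] at ha ha'
  obtain ⟨i, hi⟩ : ∃ i, b i a ≠ b i a' := by
    by_contra h
    push Not at h
    exact hne (hsep a a' ha ha' h)
  have hC := h1 i (b i a) ⟨a, ha, rfl⟩
  have hC' := h1 i (b i a') ⟨a', ha', rfl⟩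
  have hsum := card_add_card_le (u := univ.filter fun x => r x = true)
    (s := univ.filter fun x => r x = true ∧ b i x = b i a)
    (t := univ.filter fun x => r x = true ∧ b i x = b i a')
    (fun x hx => by simp only [mem_filter, mem_univ, true_and] at hx ⊢; exact hx.1)
    (fun x hx => by simp only [mem_filter, mem_univ, true_and] at hx ⊢; exact hx.1)
    (disjoint_filter.mpr fun x _ hx hx' => hi (hx.2.symm.trans hx'.2))
  omega

/-- **Two-cell kernel.** If the coordinates `b i` separate the points of `supp r` (`≥ 2` of them), `T ≥ 2`, and
every non-empty quarter-cell `supp r ∩ {b i = v, b j = w}` has `≥ T` points, then `#supp r ≥ 4T`: two points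
differ in some coordinate `i`; one of its half-cells `D` has `T ≤ |D| < 2T`, so no coordinate splits `D`, and the
`≥ 2` points of `D` are not separated. [folklore] -/
theorem two_cell_kernel {α : Type*} [Fintype α] {ι : Type*} (r : α → Bool) (b : ι → α → Bool) (T : ℕ)
    (hT : 2 ≤ T)
    (h2 : ∀ i j (v w : Bool), (∃ a, r a = true ∧ b i a = v ∧ b j a = w) →
      T ≤ #(univ.filter fun a => r a = true ∧ b i a = v ∧ b j a = w))
    (hsep : ∀ a a', r a = true → r a' = true → (∀ i, b i a = b i a') → a = a')
    (htwo : 2 ≤ #(univ.filter fun a => r a = true))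
    (hlt : #(univ.filter fun a => r a = true) < 4 * T) : False := by
  classical
  -- half-cells are diagonal quarter-cells
  have h1 : ∀ i (v : Bool), (∃ a, r a = true ∧ b i a = v) →
      T ≤ #(univ.filter fun a => r a = true ∧ b i a = v) := by
    rintro i v ⟨a, ha, hav⟩
    have e : (univ.filter fun a => r a = true ∧ b i a = v ∧ b i a = v) =
        univ.filter fun a => r a = true ∧ b i a = v :=
      filter_congr fun x _ => by rw [and_self]
    have := h2 i i v v ⟨a, ha, hav, hav⟩
    rwa [e] at this
  -- a small non-empty half-cell is impossible
  have key : ∀ i d, r d = true → #(univ.filter fun x => r x = true ∧ b i x = b i d) < 2 * T → False := by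
    intro i d hd hsmall
    have hD : T ≤ #(univ.filter fun x => r x = true ∧ b i x = b i d) := h1 i (b i d) ⟨d, hd, rfl⟩
    obtain ⟨x, hx, x', hx', hxx'⟩ := one_lt_card.mp (lt_of_lt_of_le (by omega) hD)
    simp only [mem_filter, mem_univ, true_and] at hx hx'
    refine hxx' (hsep x x' hx.1 hx'.1 fun j => ?_)
    by_contra hj
    have hE := h2 i j (b i d) (b j x) ⟨x, hx.1, hx.2, rfl⟩
    have hE' := h2 i j (b i d) (b j x') ⟨x', hx'.1, hx'.2, rfl⟩
    have hsum := card_add_card_le (u := univ.filter fun z => r z = true ∧ b i z = b i d)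
      (s := univ.filter fun z => r z = true ∧ b i z = b i d ∧ b j z = b j x)
      (t := univ.filter fun z => r z = true ∧ b i z = b i d ∧ b j z = b j x')
      (fun z hz => by simp only [mem_filter, mem_univ, true_and] at hz ⊢; exact ⟨hz.1, hz.2.1⟩)
      (fun z hz => by simp only [mem_filter, mem_univ, true_and] at hz ⊢; exact ⟨hz.1, hz.2.1⟩)
      (disjoint_filter.mpr fun z _ hz hz' => hj (hz.2.2.symm.trans hz'.2.2))
    omega
  obtain ⟨a, ha, a', ha', hne⟩ := one_lt_card.mp htwo
  simp only [mem_filter, mem_univ, true_and] at ha ha'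
  obtain ⟨i, hi⟩ : ∃ i, b i a ≠ b i a' := by
    by_contra h
    push Not at h
    exact hne (hsep a a' ha ha' h)
  have hsum := card_add_card_le (u := univ.filter fun x => r x = true)
    (s := univ.filter fun x => r x = true ∧ b i x = b i a)
    (t := univ.filter fun x => r x = true ∧ b i x = b i a')
    (fun x hx => by simp only [mem_filter, mem_univ, true_and] at hx ⊢; exact hx.1)
    (fun x hx => by simp only [mem_filter, mem_univ, true_and] at hx ⊢; exact hx.1)
    (disjoint_filter.mpr fun x _ hx hx' => hi (hx.2.symm.trans hx'.2))
  by_cases hsmall : #(univ.filter fun x => r x = true ∧ b i x = b i a) < 2 * T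
  · exact key i a ha hsmall
  · exact key i a' ha' (by omega)

/-! ### Cells of the residual have weight `0` or `≥ 2^{s-k}` -/

/-- **Cell weight.** For mutually inverse coordinatewise quadratic `π, τ` on `𝔽₂ˢ`, cubic `c₁, c₂` and `q` of degree
`d₂` with the product test `(2, d₂)` available (`5 + 2d₂ < s`, `7 + d₂ < s`), the cell `(c₁ ⊕ c₂∘π) ∧ q∘π` is
orthogonal to `RM(2,s)` (`productTest`), hence of degree `≤ k` whenever `s ≤ k + 3` (`isDegLeFun_of_orthogonal`),
hence empty or of weight `≥ 2^{s−k}` (`bb_rmWeight_holds`). [folklore] -/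
theorem cell_weight {s d₂ k : ℕ} (π τ : (Fin s → Bool) → (Fin s → Bool))
    (hπ : ∀ i, IsDegLeFun 2 (fun y => π y i)) (hτ : ∀ i, IsDegLeFun 2 (fun x => τ x i))
    (hτπ : ∀ y, τ (π y) = y) (hπτ : ∀ x, π (τ x) = x)
    (c₁ c₂ : (Fin s → Bool) → Bool) (h₁ : IsDegLeFun 3 c₁) (h₂ : IsDegLeFun 3 c₂)
    (hs₁ : 3 + 2 + 2 * d₂ < s) (hs₂ : 3 + d₂ + 2 * 2 < s) (hk : s ≤ 2 + k + 1)
    (q : (Fin s → Bool) → Bool) (hq : IsDegLeFun d₂ q)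
    (hex : ∃ y, (c₁ y ^^ c₂ (π y)) = true ∧ q (π y) = true) :
    2 ^ s ≤ 2 ^ k * #(univ.filter fun y => (c₁ y ^^ c₂ (π y)) = true ∧ q (π y) = true) := by
  classical
  have horth : ∀ p : (Fin s → Bool) → Bool, IsDegLeFun 2 p →
      Even #(univ.filter fun y : Fin s → Bool => (p y && ((c₁ y ^^ c₂ (π y)) && q (π y))) = true) := by
    intro p hp
    have key := productTest π τ hπ hτ hτπ hπτ c₁ c₂ h₁ h₂ p q hp hq hs₁ hs₂
    have hset : (univ.filter fun y : Fin s → Bool => (p y && ((c₁ y ^^ c₂ (π y)) && q (π y))) = true) =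
        univ.filter fun y : Fin s → Bool => ((c₁ y ^^ c₂ (π y)) && (p y && q (π y))) = true :=
      filter_congr fun y _ => by rw [Bool.and_left_comm]
    rw [hset]
    exact key
  have hdeg : IsDegLeFun k (fun y : Fin s → Bool => (c₁ y ^^ c₂ (π y)) && q (π y)) :=
    isDegLeFun_of_orthogonal hk horth
  obtain ⟨y₀, hy₀, hq₀⟩ := hex
  have hw := bb_rmWeight_holds s k _ hdeg ⟨y₀, by simp [hy₀, hq₀]⟩
  have hset : (univ.filter fun y : Fin s → Bool => ((c₁ y ^^ c₂ (π y)) && q (π y)) = true) =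
      univ.filter fun y : Fin s → Bool => (c₁ y ^^ c₂ (π y)) = true ∧ q (π y) = true :=
    filter_congr fun y _ => by rw [Bool.and_eq_true]
  rw [hset] at hw
  exact hw

/-! ### `s = 9`: BQQ(9) -/

/-- **THEOREM BQQ(9).** For mutually inverse coordinatewise quadratic `π, τ` on `𝔽₂⁹` (`τ ∘ π = id` suffices) and cubic
`c₁, c₂`, the residual `c₁ ⊕ c₂∘π` is `0` or has weight `≥ 16 = 2^{9−5}`: its coordinate half-cells are empty or
have `≥ 8` points (`cell_weight`, test `(2,1)`, `k = 6`), and `one_cell_kernel`. [folklore] -/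
theorem bqq_nine (π τ : (Fin 9 → Bool) → (Fin 9 → Bool))
    (hπ : ∀ i, IsDegLeFun 2 (fun y => π y i)) (hτ : ∀ i, IsDegLeFun 2 (fun x => τ x i))
    (hτπ : ∀ y, τ (π y) = y)
    (c₁ c₂ : (Fin 9 → Bool) → Bool) (h₁ : IsDegLeFun 3 c₁) (h₂ : IsDegLeFun 3 c₂) :
    (∀ y, c₁ y = c₂ (π y)) ∨ 16 ≤ #(univ.filter fun y => (c₁ y ^^ c₂ (π y)) = true) := by
  classical
  have hinj : Function.Injective π := fun a b hab => by rw [← hτπ a, ← hτπ b, hab]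
  have hπτ : ∀ x, π (τ x) = x := fun x => by
    obtain ⟨y, rfl⟩ := Finite.surjective_of_injective hinj x
    rw [hτπ]
  by_cases h16 : 16 ≤ #(univ.filter fun y => (c₁ y ^^ c₂ (π y)) = true)
  · exact Or.inr h16
  refine Or.inl fun y₀ => ?_
  by_contra hy₀
  have hr₀ : (c₁ y₀ ^^ c₂ (π y₀)) = true := Bool.xor_iff_ne.mpr hy₀
  -- `w ≥ 8 ≥ 2` (test `(2,0)`, `k = 6`)
  have hw := cell_weight (d₂ := 0) (k := 6) π τ hπ hτ hτπ hπτ c₁ c₂ h₁ h₂ (by norm_num) (by norm_num)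
    (by norm_num) (fun _ => true) (isDegLeFun_const 0 true) ⟨y₀, hr₀, rfl⟩
  have e0 : (univ.filter fun y : Fin 9 → Bool => (c₁ y ^^ c₂ (π y)) = true ∧ true = true) =
      univ.filter fun y => (c₁ y ^^ c₂ (π y)) = true := filter_congr fun y _ => by simp
  rw [e0] at hw
  have htwo : 2 ≤ #(univ.filter fun y : Fin 9 → Bool => (c₁ y ^^ c₂ (π y)) = true) := by
    simp only [Nat.reducePow] at hw; omega
  have hlt : #(univ.filter fun y : Fin 9 → Bool => (c₁ y ^^ c₂ (π y)) = true) < 2 * 8 := by omega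
  refine one_cell_kernel (fun y => c₁ y ^^ c₂ (π y)) (fun i y => π y i) 8 ?_ ?_ htwo hlt
  · rintro i v ⟨a, ha, hav⟩
    have hc := cell_weight (d₂ := 1) (k := 6) π τ hπ hτ hτπ hπτ c₁ c₂ h₁ h₂ (by norm_num) (by norm_num)
      (by norm_num) (fun z => z i ^^ !v) (fc_deg_bxor (isDegLeFun_apply i le_rfl) (isDegLeFun_const 1 (!v)))
      ⟨a, ha, by simpa [xor_not_eq_true_iff] using hav⟩
    have e : (univ.filter fun y : Fin 9 → Bool => (c₁ y ^^ c₂ (π y)) = true ∧ (π y i ^^ !v) = true) =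
        univ.filter fun y => (c₁ y ^^ c₂ (π y)) = true ∧ π y i = v :=
      filter_congr fun y _ => by rw [xor_not_eq_true_iff]
    rw [e] at hc
    have hc' : 8 ≤ #(univ.filter fun y : Fin 9 → Bool => (c₁ y ^^ c₂ (π y)) = true ∧ π y i = v) := by
      simp only [Nat.reducePow] at hc; omega
    exact hc'
  · intro a a' _ _ h
    exact hinj (funext h)

/-- **MM-GAP at `n = 18` (bijective biquadratic class).** With `g(y₁‖y₂)` of sign `(−1)^{y₁·π(y₂)}(−1)^{h(y₂)}`,
`f(x₁‖x₂)` of sign `(−1)^{x₂·τ(x₁)}(−1)^{r(x₁)}`, `π, τ : 𝔽₂⁹ → 𝔽₂⁹` of degree `≤ 2`, `τ ∘ π = id`, `h, r` cubic: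
`Φ(f,g) = 1` or `Φ(f,g) ≤ 15/16` (`Φ = 1 − 2·wt(h ⊕ r∘π)/2⁹` and `bqq_nine`). [folklore] -/
theorem forrelation_bijectiveMm_eighteen (f g : (Fin (9 + 9) → Bool) → Bool)
    (π τ : (Fin 9 → Bool) → (Fin 9 → Bool)) (h r : (Fin 9 → Bool) → Bool)
    (hg : ∀ y₁ y₂ : Fin 9 → Bool, signOf (g (Fin.append y₁ y₂)) = twist y₁ (π y₂) * signOf (h y₂))
    (hf : ∀ x₁ x₂ : Fin 9 → Bool, signOf (f (Fin.append x₁ x₂)) = twist x₂ (τ x₁) * signOf (r x₁))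
    (hπ : ∀ i, IsDegLeFun 2 (fun y => π y i)) (hτ : ∀ i, IsDegLeFun 2 (fun x => τ x i))
    (hτπ : ∀ y, τ (π y) = y) (hh : IsDegLeFun 3 h) (hr : IsDegLeFun 3 r) :
    forrelation f g = 1 ∨ forrelation f g ≤ 15 / 16 := by
  classical
  rw [forrelation_mmPair_of_leftInverse f g π τ h r hg hf hτπ]
  have e : ∀ y : Fin 9 → Bool, signOf (h y) * signOf (r (π y)) = signOf (h y ^^ r (π y)) := fun y => by
    cases h y <;> cases r (π y) <;> simp [signOf]
  simp_rw [e]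
  rw [fc_sum_signOf_eq_card]
  have h512 : ((2 : ℝ) ^ 9)⁻¹ = 1 / 512 := by norm_num
  rw [h512]
  rcases bqq_nine π τ hπ hτ hτπ h r hh hr with h0 | h16
  · left
    have hempty : (univ.filter fun y : Fin 9 → Bool => (h y ^^ r (π y)) = true) = ∅ :=
      filter_eq_empty_iff.mpr fun y _ => by rw [h0 y]; simp
    rw [hempty, card_empty, Nat.cast_zero]
    norm_num
  · right
    have h16' : (16 : ℝ) ≤ (#(univ.filter fun y : Fin 9 → Bool => (h y ^^ r (π y)) = true) : ℝ) := by
      exact_mod_cast h16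
    linarith

/-! ### `s = 10`: BQQ(10) -/

/-- **THEOREM BQQ(10).** For mutually inverse coordinatewise quadratic `π, τ` on `𝔽₂¹⁰` (`τ ∘ π = id` suffices) and
cubic `c₁, c₂`, the residual `c₁ ⊕ c₂∘π` is `0` or has weight `≥ 32 = 2^{10−5}`: its coordinate quarter-cells are
empty or have `≥ 8` points (`cell_weight`, test `(2,2)`, `k = 7`), and `two_cell_kernel`. SHARP: weight `32`
occurs (`PentagonFifteenSixteenths`, `Φ = 15/16` at `n = 20`). [folklore] -/
theorem bqq_ten (π τ : (Fin 10 → Bool) → (Fin 10 → Bool))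
    (hπ : ∀ i, IsDegLeFun 2 (fun y => π y i)) (hτ : ∀ i, IsDegLeFun 2 (fun x => τ x i))
    (hτπ : ∀ y, τ (π y) = y)
    (c₁ c₂ : (Fin 10 → Bool) → Bool) (h₁ : IsDegLeFun 3 c₁) (h₂ : IsDegLeFun 3 c₂) :
    (∀ y, c₁ y = c₂ (π y)) ∨ 32 ≤ #(univ.filter fun y => (c₁ y ^^ c₂ (π y)) = true) := by
  classical
  have hinj : Function.Injective π := fun a b hab => by rw [← hτπ a, ← hτπ b, hab]
  have hπτ : ∀ x, π (τ x) = x := fun x => by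
    obtain ⟨y, rfl⟩ := Finite.surjective_of_injective hinj x
    rw [hτπ]
  by_cases h32 : 32 ≤ #(univ.filter fun y => (c₁ y ^^ c₂ (π y)) = true)
  · exact Or.inr h32
  refine Or.inl fun y₀ => ?_
  by_contra hy₀
  have hr₀ : (c₁ y₀ ^^ c₂ (π y₀)) = true := Bool.xor_iff_ne.mpr hy₀
  -- `w ≥ 8 ≥ 2` (test `(2,0)`, `k = 7`)
  have hw := cell_weight (d₂ := 0) (k := 7) π τ hπ hτ hτπ hπτ c₁ c₂ h₁ h₂ (by norm_num) (by norm_num)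
    (by norm_num) (fun _ => true) (isDegLeFun_const 0 true) ⟨y₀, hr₀, rfl⟩
  have e0 : (univ.filter fun y : Fin 10 → Bool => (c₁ y ^^ c₂ (π y)) = true ∧ true = true) =
      univ.filter fun y => (c₁ y ^^ c₂ (π y)) = true := filter_congr fun y _ => by simp
  rw [e0] at hw
  have htwo : 2 ≤ #(univ.filter fun y : Fin 10 → Bool => (c₁ y ^^ c₂ (π y)) = true) := by
    simp only [Nat.reducePow] at hw; omega
  have hlt : #(univ.filter fun y : Fin 10 → Bool => (c₁ y ^^ c₂ (π y)) = true) < 4 * 8 := by omega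
  refine two_cell_kernel (fun y => c₁ y ^^ c₂ (π y)) (fun i y => π y i) 8 (by norm_num) ?_ ?_ htwo hlt
  · rintro i j v w ⟨a, ha, hav, haw⟩
    have hc := cell_weight (d₂ := 2) (k := 7) π τ hπ hτ hτπ hπτ c₁ c₂ h₁ h₂ (by norm_num) (by norm_num)
      (by norm_num) (fun z => (z i ^^ !v) && (z j ^^ !w))
      (te_isDegLeFun_band (a := 1) (b := 1)
        (fc_deg_bxor (isDegLeFun_apply i le_rfl) (isDegLeFun_const 1 (!v)))
        (fc_deg_bxor (isDegLeFun_apply j le_rfl) (isDegLeFun_const 1 (!w))))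
      ⟨a, ha, by simpa [xor_not_eq_true_iff] using And.intro hav haw⟩
    have e : (univ.filter fun y : Fin 10 → Bool =>
          (c₁ y ^^ c₂ (π y)) = true ∧ ((π y i ^^ !v) && (π y j ^^ !w)) = true) =
        univ.filter fun y => (c₁ y ^^ c₂ (π y)) = true ∧ π y i = v ∧ π y j = w :=
      filter_congr fun y _ => by rw [Bool.and_eq_true, xor_not_eq_true_iff, xor_not_eq_true_iff]
    rw [e] at hc
    have hc' : 8 ≤ #(univ.filter fun y : Fin 10 → Bool =>
        (c₁ y ^^ c₂ (π y)) = true ∧ π y i = v ∧ π y j = w) := by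
      simp only [Nat.reducePow] at hc; omega
    exact hc'
  · intro a a' _ _ h
    exact hinj (funext h)

/-- **MM-GAP at `n = 20` (bijective biquadratic class), sharp.** Same shape as `forrelation_bijectiveMm_eighteen`
with `π, τ : 𝔽₂¹⁰ → 𝔽₂¹⁰`: `Φ(f,g) = 1` or `Φ(f,g) ≤ 15/16`; the value `15/16` is attained in this class at
`n = 20` (`PentagonFifteenSixteenths.exists_bijectiveMm_pair_fifteen_sixteenths`). [folklore] -/
theorem forrelation_bijectiveMm_twenty (f g : (Fin (10 + 10) → Bool) → Bool)
    (π τ : (Fin 10 → Bool) → (Fin 10 → Bool)) (h r : (Fin 10 → Bool) → Bool)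
    (hg : ∀ y₁ y₂ : Fin 10 → Bool, signOf (g (Fin.append y₁ y₂)) = twist y₁ (π y₂) * signOf (h y₂))
    (hf : ∀ x₁ x₂ : Fin 10 → Bool, signOf (f (Fin.append x₁ x₂)) = twist x₂ (τ x₁) * signOf (r x₁))
    (hπ : ∀ i, IsDegLeFun 2 (fun y => π y i)) (hτ : ∀ i, IsDegLeFun 2 (fun x => τ x i))
    (hτπ : ∀ y, τ (π y) = y) (hh : IsDegLeFun 3 h) (hr : IsDegLeFun 3 r) :
    forrelation f g = 1 ∨ forrelation f g ≤ 15 / 16 := by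
  classical
  rw [forrelation_mmPair_of_leftInverse f g π τ h r hg hf hτπ]
  have e : ∀ y : Fin 10 → Bool, signOf (h y) * signOf (r (π y)) = signOf (h y ^^ r (π y)) := fun y => by
    cases h y <;> cases r (π y) <;> simp [signOf]
  simp_rw [e]
  rw [fc_sum_signOf_eq_card]
  have h1024 : ((2 : ℝ) ^ 10)⁻¹ = 1 / 1024 := by norm_num
  rw [h1024]
  rcases bqq_ten π τ hπ hτ hτπ h r hh hr with h0 | h32
  · left
    have hempty : (univ.filter fun y : Fin 10 → Bool => (h y ^^ r (π y)) = true) = ∅ :=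
      filter_eq_empty_iff.mpr fun y _ => by rw [h0 y]; simp
    rw [hempty, card_empty, Nat.cast_zero]
    norm_num
  · right
    have h32' : (32 : ℝ) ≤ (#(univ.filter fun y : Fin 10 → Bool => (h y ^^ r (π y)) = true) : ℝ) := by
      exact_mod_cast h32
    linarith

end Summit.QuantumAdvantage.QuantumAdvantage.Theorems.NearExactIsExact.Negative.BqqNineTen
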